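import Literature.Probability.Percolation.AdjSurgery4
import Literature.Probability.Percolation.ArmSeparationRawGoodUp
import Literature.Probability.Percolation.ArmSeparationInnerBoundAt
import Literature.Probability.Percolation.ArmSeparationOuterFail
import Literature.Probability.Percolation.CerfTwoArmsProofs
import HarnessLib

/-!
# The good event of the adjacent landing: its probabilistic form, locality and failure bound

Topic `Literature/Probability/Percolation`; family `crit-perc` / near-critical percolation on `𝕋`.
A brick of the near-critical arm-separation theorem for four arms in the ADJACENT colour
arrangement (P. Nolin, EJP 13 (2008), Thm. 11, `j = 4`, `σ = BBWW` [arXiv 0711.4948: Thm. 10],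
§4.4 Lemma 15 [arXiv Lemma 14] and its use in the proof of Thm. 11, "by independence"):

* `AdjGoodP` — the PROBABILISTIC good event behind the six sides and for both colours: both
  lowest-crossing explorations short and rawly good at some scale at every term, and guards
  (`InGuard`) at the two corners and at the midpoint of the side; `adjGood_of_adjGoodP` — it
  implies the deterministic good event `AdjGood` of the surgery (middle term tips and the midpoint
  frame come from the guards);
* `outAdjFinset M` (sites of norm in `(M, 4M]`), `determinedBy_setOf_not_adjGoodP` — locality
  outside `Λ_M`; `real_le_adjStep_at` — the separation step "by independence";
* `real_not_adjGoodP_le_at` — **`P_p(¬ AdjGoodP) ≤ 12 · (2 (1-c₄)^{T+1}·… )`**, from the stop bounds,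
  the raw failure bounds and the guard bounds at `p` and `1 - p`.

Everything here is proved; no named facts are introduced.

## References

* P. Nolin, Near-critical percolation in two dimensions, *Electron. J. Probab.* 13 (2008), §4.4
  Lemma 15 and Thm. 11 (proof) (arXiv 0711.4948: Lemma 14 (4.20), Thm. 10) [Nolin2008].
* H. Kesten, Scaling relations for 2D-percolation, *Comm. Math. Phys.* 109 (1987), Lemma 2 [Kesten1987].
-/

noncomputable section

open Set MeasureTheory unitInterval

namespace Literature.Probability.Percolation

open LatticeModels

/-! ### The probabilistic good event -/

/-- **The good event behind one side, probabilistic form**: short and rawly good explorations from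
below and from above, and guards at the two corners and at the midpoint of the side. [cite: Nolin2008, §4.4 Lemma 15 and Thm. 11 (proof) (arXiv 0711.4948: Lemma 14, Thm. 10)] -/
def SideGoodP (M k₀ K T T' Rg Kg : ℕ) (χ : SiteConfig (Site 2)) : Prop :=
  (trapDomain M).lowestSeq χ T = none ∧ (∀ u < T, ¬ TrapSeqFailRaw M u k₀ K χ) ∧
  (trapDomain M).flip.lowestSeq χ T' = none ∧ (∀ u < T', ¬ TrapSeqFailRawUp M u k₀ K χ) ∧
  InGuard Rg Kg (extC₁ M) χ ∧ InGuard Rg Kg (extC₂ M) χ ∧ InGuard Rg Kg (extC₃ M) χ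

/-- **The good event around `∂Λ_{2M}`, probabilistic form.** [cite: Nolin2008, §4.4 Lemma 15 and Thm. 11 (proof) (arXiv 0711.4948: Lemma 14, Thm. 10)] -/
def AdjGoodP (M k₀ K T T' Rg Kg : ℕ) (ω : SiteConfig (Site 2)) : Prop :=
  ∀ f < 6, ∀ b : Bool, SideGoodP M k₀ K T T' Rg Kg (rotConfig f (colCfg b ω))

/-- **The probabilistic good event implies the deterministic one** (`R_g > 8 k_{K-1}`,
`2 R_g 32^l + 1 ≤ M`): middle term tips and the midpoint frame come from the guards. [cite: Nolin2008, §4.4 Thm. 11 (proof) (arXiv 0711.4948: Thm. 10)] -/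
theorem adjGood_of_adjGoodP {P : OParams} {T T' Rg Kg : ℕ} (hRg : 8 * trapScale P.k₀ (P.K - 1) + 1 ≤ Rg)
    (hRgM : ∀ l < Kg, 2 * trapScale Rg l + 1 ≤ P.M) {ω : SiteConfig (Site 2)} (h : AdjGoodP P.M P.k₀ P.K T T' Rg Kg ω) :
    AdjGood P T T' Rg Kg ω := by
  intro f hf b
  obtain ⟨h1, h2, h3, h4, g₁, g₂, g₃⟩ := h f hf b
  obtain ⟨R₁, R₂, hR₁, hR₁M, hR₂, hR₂M, hdn, hup⟩ := frames_of_inGuard hRgM g₁ g₂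
  have hκj : ∀ j < P.K, 8 * (trapScale P.k₀ j : ℤ) < Rg := fun j hj => by
    have := trapScale_mono P.k₀ (show j ≤ P.K - 1 by omega); omega
  refine ⟨⟨h1, h2, h3, h4, fun u c z hu j hj => ?_, fun u d z hu j hj => ?_, ?_⟩, g₁, g₂⟩
  · have hb := term_tip_bounds_of_guards (by omega) hR₁M (by omega) hR₂M hdn hup hu
    have := hκj j hj; constructor <;> omega
  · have hb := termUp_tip_bounds_of_guards (by omega) hR₁M (by omega) hR₂M hdn hup hu
    have := hκj j hj; constructor <;> omega
  · obtain ⟨l, hl, hg⟩ := g₃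
    refine ⟨trapScale Rg l, le_trans (by omega) (le_trapScale Rg l), hRgM l hl, hg.1⟩

/-! ### Locality outside `Λ_M` -/

/-- The sites read by the good event: norms in `(M, 4M]`. [folklore] -/
def outAdjFinset (M : ℕ) : Finset (Site 2) := (triBall (4 * M)).filter fun v => (M : ℤ) < triNorm v

/-- Membership in `outAdjFinset`. [folklore] -/
theorem mem_outAdjFinset {M : ℕ} {v : Site 2} : v ∈ outAdjFinset M ↔ (M : ℤ) < triNorm v ∧ triNorm v ≤ 4 * M := by
  rw [outAdjFinset, Finset.mem_filter, mem_triBall_iff]; push_cast; tauto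

/-- `outAdjFinset M` is disjoint from `Λ_M`. [folklore] -/
theorem disjoint_outAdjFinset_triBall (M : ℕ) : Disjoint (outAdjFinset M) (triBall M) := by
  rw [Finset.disjoint_left]
  intro v hv hvB
  have h1 := (mem_outAdjFinset.1 hv).1
  have h2 := mem_triBall_iff.1 hvB
  omega

/-- `outAdjFinset` is stable under the rotations. [folklore] -/
theorem image_rot_outAdjFinset (M i : ℕ) : triRotIsoPow i '' (↑(outAdjFinset M) : Set (Site 2)) ⊆ ↑(outAdjFinset M) := by
  rintro v ⟨w, hw, rfl⟩
  rw [Finset.mem_coe, mem_outAdjFinset] at hw ⊢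
  rw [triNorm_triRotIsoPow]; exact hw

/-- A site near a point of norm `2M`: within sup-distance `R < M` of `z` with `|z| = 2M` (or of a
point of the trapezoid) the norm is in `(M, 4M]`. [folklore] -/
theorem mem_outAdjFinset_of_near {M R : ℕ} (hRM : R < M) {z v : Site 2} (hz : (M : ℤ) + R < z 0 ∧ triNorm z ≤ 2 * M)
    (hv : z 0 - R ≤ v 0 ∧ v 0 ≤ z 0 + R ∧ z 1 - R ≤ v 1 ∧ v 1 ≤ z 1 + R) : v ∈ outAdjFinset M := by
  rw [mem_outAdjFinset]
  have hzl := triNorm_le_iff_lin.1 hz.2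
  constructor
  · exact lt_of_lt_of_le (by omega) (le_triNorm_iff_lin.2 (Or.inl le_rfl))
  · exact triNorm_le_iff_lin.2 (by omega)

/-- The trapezoid lies in `outAdjFinset`. [folklore] -/
theorem trapD_subset_outAdjFinset (M : ℕ) : trapD M ⊆ outAdjFinset M := fun v hv => by
  rw [mem_outAdjFinset]
  obtain ⟨h0, h0', h1, h01⟩ := mem_trapD.1 hv
  constructor
  · exact lt_of_lt_of_le h0 (le_triNorm_iff_lin.2 (Or.inl le_rfl))
  · exact triNorm_le_iff_lin.2 (by omega)

/-- The wide annuli about a point of `trapO` lie in `outAdjFinset` (`31 k_{K-1} < M`). [folklore] -/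
theorem trapScalesFinset₂_subset {M k₀ K : ℕ} (hKM : ∀ j < K, 31 * trapScale k₀ j < M) {z : Site 2} (hz : z ∈ trapO M) :
    trapScalesFinset₂ z k₀ K ⊆ outAdjFinset M := by
  intro v hv
  rw [trapScalesFinset₂, Finset.mem_biUnion] at hv
  obtain ⟨j, hj, hv⟩ := hv
  have hb := (mem_triSqAnnulusFinset.1 hv).1
  have hz' := trapO_coord hz
  have hjM := hKM j (Finset.mem_range.1 hj)
  refine mem_outAdjFinset_of_near (R := 31 * trapScale k₀ j) (z := z) hjM ⟨?_, ?_⟩ ?_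
  · push_cast; omega
  · exact triNorm_le_iff_lin.2 (by omega)
  · push_cast at hb ⊢; exact hb

/-- Raw failure of the `u`-th term from below is determined by `outAdjFinset`. [folklore] -/
theorem determinedBy_setOf_trapSeqFailRaw {M u k₀ K : ℕ} (hM : 1 ≤ M) (hKM : ∀ j < K, 31 * trapScale k₀ j < M) :
    DeterminedBy {ω : SiteConfig (Site 2) | TrapSeqFailRaw M u k₀ K ω} ↑(outAdjFinset M) := by
  classical
  have hcut := trapDomain_cutProp M
  have hdual := trapDomain_dualProp hM
  have hset : {ω : SiteConfig (Site 2) | TrapSeqFailRaw M u k₀ K ω} =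
      ⋃ q ∈ (trapPairs M : Set (Finset (Site 2) × Site 2)),
        ({ω | (trapDomain M).lowestSeq ω u = some (q.1, q.2)} ∩ {ω | TrapNoRSW₃ M q.1 q.2 k₀ K ω}) := by
    ext ω
    simp only [Set.mem_setOf_eq, Set.mem_iUnion, Set.mem_inter_iff, exists_prop]
    constructor
    · rintro ⟨c, z, hu, hfail⟩
      exact ⟨(c, z), Finset.mem_coe.2 (mem_trapPairs_of_lowestSeq hu), hu, trapNoRSW₃_of_failRaw hfail⟩
    · rintro ⟨⟨c, z⟩, -, hu, hno⟩
      exact ⟨c, z, hu, fun j hj hok => by obtain ⟨ω', hagree, hω'⟩ := hok; exact hno j hj ω' hagree hω'⟩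
  rw [hset]
  refine DeterminedBy.biUnion fun q hq => ?_
  obtain ⟨c, z⟩ := q
  have hq' := Finset.mem_coe.1 hq
  rw [trapPairs, Finset.mem_product, Finset.mem_powerset] at hq'
  refine ((JDomain.determinedBy_lowestSeq_eq hcut hdual u c z).mono ?_).inter ((determinedBy_trapNoRSW₃ M c z k₀ K).mono ?_)
  · intro v hv
    exact Finset.mem_coe.2 (trapD_subset_outAdjFinset M (JDomain.lower_subset_D hq'.1 (Finset.mem_coe.1 hv)))
  · intro v hv
    exact Finset.mem_coe.2 (trapScalesFinset₂_subset hKM hq'.2 (Finset.sdiff_subset (Finset.mem_coe.1 hv)))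

/-- Raw failure of the `u`-th term from above is determined by `outAdjFinset`. [folklore] -/
theorem determinedBy_setOf_trapSeqFailRawUp {M u k₀ K : ℕ} (hM : 1 ≤ M) (hKM : ∀ j < K, 31 * trapScale k₀ j < M) :
    DeterminedBy {ω : SiteConfig (Site 2) | TrapSeqFailRawUp M u k₀ K ω} ↑(outAdjFinset M) := by
  classical
  have hcut : (trapDomain M).flip.CutProp := JDomain.flip_cutProp (trapDomain_cutProp M)
  have hdual : (trapDomain M).flip.DualProp := JDomain.flip_dualProp (trapDomain_dualProp hM)
  have hset : {ω : SiteConfig (Site 2) | TrapSeqFailRawUp M u k₀ K ω} =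
      ⋃ q ∈ (trapPairs M : Set (Finset (Site 2) × Site 2)),
        ({ω | (trapDomain M).flip.lowestSeq ω u = some (q.1, q.2)} ∩ {ω | TrapNoRSWL ((trapDomain M).flip.lower q.1 q.2) q.2 k₀ K ω}) := by
    ext ω
    simp only [Set.mem_setOf_eq, Set.mem_iUnion, Set.mem_inter_iff, exists_prop]
    constructor
    · rintro ⟨d, z, hu, hfail⟩
      exact ⟨(d, z), Finset.mem_coe.2 (mem_trapPairs_of_flip_lowestSeq hu), hu, trapNoRSWL_of_failRawUp hfail⟩
    · rintro ⟨⟨d, z⟩, -, hu, hno⟩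
      exact ⟨d, z, hu, fun j hj hok => by obtain ⟨ω', hagree, hω'⟩ := hok; exact hno j hj ω' hagree hω'⟩
  rw [hset]
  refine DeterminedBy.biUnion fun q hq => ?_
  obtain ⟨d, z⟩ := q
  have hq' := Finset.mem_coe.1 hq
  rw [trapPairs, Finset.mem_product, Finset.mem_powerset] at hq'
  refine ((JDomain.determinedBy_lowestSeq_eq hcut hdual u d z).mono ?_).inter ((determinedBy_trapNoRSWL _ z k₀ K).mono ?_)
  · intro v hv
    have h := JDomain.lower_subset_D (Q := (trapDomain M).flip) hq'.1 (Finset.mem_coe.1 hv)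
    exact Finset.mem_coe.2 (trapD_subset_outAdjFinset M h)
  · intro v hv
    exact Finset.mem_coe.2 (trapScalesFinset₂_subset hKM hq'.2 (Finset.sdiff_subset (Finset.mem_coe.1 hv)))

/-- The stop events are determined by the trapezoid. [folklore] -/
theorem determinedBy_setOf_lowestSeq_none {M T : ℕ} (hM : 1 ≤ M) :
    DeterminedBy {ω : SiteConfig (Site 2) | (trapDomain M).lowestSeq ω T = none} ↑(outAdjFinset M) := by
  rw [determinedBy_iff]
  intro ω ω' hωω'
  simp only [Set.mem_setOf_eq]
  rw [lowestSeq_eq_of_agree hM (fun v hv => ?_) T]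
  have := Set.ext_iff.1 hωω' v
  simp only [Set.mem_inter_iff, Finset.mem_coe] at this
  have hv' := trapD_subset_outAdjFinset M hv
  exact ⟨fun h1 => (this.1 ⟨h1, hv'⟩).1, fun h2 => (this.2 ⟨h2, hv'⟩).1⟩

/-- The stop events of the exploration from above are determined by the trapezoid. [folklore] -/
theorem determinedBy_setOf_flip_lowestSeq_none {M T : ℕ} (hM : 1 ≤ M) :
    DeterminedBy {ω : SiteConfig (Site 2) | (trapDomain M).flip.lowestSeq ω T = none} ↑(outAdjFinset M) := by
  have hcut : (trapDomain M).flip.CutProp := JDomain.flip_cutProp (trapDomain_cutProp M)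
  have hdual : (trapDomain M).flip.DualProp := JDomain.flip_dualProp (trapDomain_dualProp hM)
  rw [determinedBy_iff]
  intro ω ω' hωω'
  simp only [Set.mem_setOf_eq]
  have hag : ∀ v ∈ trapD M, v ∈ ω ↔ v ∈ ω' := fun v hv => by
    have := Set.ext_iff.1 hωω' v
    simp only [Set.mem_inter_iff, Finset.mem_coe] at this
    have hv' := trapD_subset_outAdjFinset M hv
    exact ⟨fun h1 => (this.1 ⟨h1, hv'⟩).1, fun h2 => (this.2 ⟨h2, hv'⟩).1⟩
  have key : ∀ (χ χ' : Set (Site 2)), (∀ v ∈ trapD M, v ∈ χ ↔ v ∈ χ') → ∀ q,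
      (trapDomain M).flip.lowestSeq χ T = some q → (trapDomain M).flip.lowestSeq χ' T = some q := by
    rintro χ χ' hχ ⟨d, z⟩ hq
    exact (JDomain.lowestSeq_congr hcut hdual fun v hv =>
      hχ v (JDomain.lower_subset_D (Q := (trapDomain M).flip) (JDomain.isCrossing_of_lowestSeq hq).1.subset hv)).1 hq
  constructor
  · intro h
    cases h' : (trapDomain M).flip.lowestSeq ω' T with
    | none => rfl
    | some q => rw [key ω' ω (fun v hv => (hag v hv).symm) q h'] at h; exact absurd h (by simp)
  · intro h
    cases h' : (trapDomain M).flip.lowestSeq ω T with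
    | none => rfl
    | some q => rw [key ω ω' hag q h'] at h; exact absurd h (by simp)

/-- Guards at a point `C` with `M + R_g' < C₀`, `|C| ≤ 2M`, `R_g' < M` are determined by `outAdjFinset`. [folklore] -/
theorem determinedBy_setOf_inGuard_out {M Rg Kg Rg' : ℕ} (hRg : ∀ l < Kg, 16 * trapScale Rg l ≤ Rg') (hRg'M : Rg' < M)
    {C : Site 2} (hC : (M : ℤ) + Rg' < C 0 ∧ triNorm C ≤ 2 * M) :
    DeterminedBy {χ : SiteConfig (Site 2) | InGuard Rg Kg C χ} ↑(outAdjFinset M) := by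
  refine (determinedBy_setOf_inGuard hRg C).mono fun v hv => ?_
  rw [Finset.mem_coe, mem_triSquareFinset] at hv
  exact Finset.mem_coe.2 (mem_outAdjFinset_of_near hRg'M hC hv)

/-- Finite intersections of determined events are determined. [folklore] -/
theorem DeterminedBy.biInter' {ι κ : Type*} {s : Set κ} {A : κ → Set (Set ι)} {F : Set ι}
    (h : ∀ k ∈ s, DeterminedBy (A k) F) : DeterminedBy (⋂ k ∈ s, A k) F := by
  have e : (⋂ k ∈ s, A k) = (⋃ k ∈ s, (A k)ᶜ)ᶜ := by ext; simp
  rw [e]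
  exact (DeterminedBy.biUnion fun k hk => (h k hk).compl).compl

/-- **One side's good event is determined by `outAdjFinset M`.** [cite: Nolin2008, §4.4 (arXiv 0711.4948: proof of Thm. 10, "by independence")] -/
theorem determinedBy_setOf_sideGoodP {M k₀ K T T' Rg Kg Rg' : ℕ} (hM : 1 ≤ M) (hKM : ∀ j < K, 31 * trapScale k₀ j < M)
    (hRg : ∀ l < Kg, 16 * trapScale Rg l ≤ Rg') (hRg'M : Rg' < M) :
    DeterminedBy {χ : SiteConfig (Site 2) | SideGoodP M k₀ K T T' Rg Kg χ} ↑(outAdjFinset M) := by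
  have hM' : (M : ℤ) + Rg' < 2 * M := by omega
  have hC₁ : (M : ℤ) + Rg' < extC₁ M 0 ∧ triNorm (extC₁ M) ≤ 2 * M := by
    refine ⟨by simp [extC₁]; omega, triNorm_le_iff_lin.2 ?_⟩; simp [extC₁]
  have hC₂ : (M : ℤ) + Rg' < extC₂ M 0 ∧ triNorm (extC₂ M) ≤ 2 * M := by
    refine ⟨by simp [extC₂]; omega, triNorm_le_iff_lin.2 ?_⟩; simp [extC₂]
  have hC₃ : (M : ℤ) + Rg' < extC₃ M 0 ∧ triNorm (extC₃ M) ≤ 2 * M := by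
    refine ⟨by simp [extC₃]; omega, triNorm_le_iff_lin.2 ?_⟩; simp [extC₃]; omega
  have e : {χ : SiteConfig (Site 2) | SideGoodP M k₀ K T T' Rg Kg χ} =
      {χ | (trapDomain M).lowestSeq χ T = none} ∩ (⋂ u ∈ Finset.range T, {χ | TrapSeqFailRaw M u k₀ K χ}ᶜ) ∩
      {χ | (trapDomain M).flip.lowestSeq χ T' = none} ∩ (⋂ u ∈ Finset.range T', {χ | TrapSeqFailRawUp M u k₀ K χ}ᶜ) ∩
      {χ | InGuard Rg Kg (extC₁ M) χ} ∩ {χ | InGuard Rg Kg (extC₂ M) χ} ∩ {χ | InGuard Rg Kg (extC₃ M) χ} := by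
    ext χ; simp only [SideGoodP, Set.mem_setOf_eq, Set.mem_inter_iff, Set.mem_iInter, Set.mem_compl_iff, Finset.mem_range]; tauto
  rw [e]
  refine (((((((determinedBy_setOf_lowestSeq_none hM).inter ?_).inter (determinedBy_setOf_flip_lowestSeq_none hM)).inter ?_).inter
    (determinedBy_setOf_inGuard_out hRg hRg'M hC₁)).inter (determinedBy_setOf_inGuard_out hRg hRg'M hC₂)).inter
    (determinedBy_setOf_inGuard_out hRg hRg'M hC₃))
  · exact DeterminedBy.biInter' fun u _ => (determinedBy_setOf_trapSeqFailRaw hM hKM).compl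
  · exact DeterminedBy.biInter' fun u _ => (determinedBy_setOf_trapSeqFailRawUp hM hKM).compl

/-- **`{¬ AdjGoodP}` is determined by `outAdjFinset M`** — sites of norm in `(M, 4M]`. [cite: Nolin2008, §4.4 (arXiv 0711.4948: proof of Thm. 10, "by independence")] -/
theorem determinedBy_setOf_not_adjGoodP {M k₀ K T T' Rg Kg Rg' : ℕ} (hM : 1 ≤ M) (hKM : ∀ j < K, 31 * trapScale k₀ j < M)
    (hRg : ∀ l < Kg, 16 * trapScale Rg l ≤ Rg') (hRg'M : Rg' < M) :
    DeterminedBy {ω : SiteConfig (Site 2) | ¬ AdjGoodP M k₀ K T T' Rg Kg ω} ↑(outAdjFinset M) := by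
  have hside := determinedBy_setOf_sideGoodP (T := T) (T' := T') hM hKM hRg hRg'M
  have e : {ω : SiteConfig (Site 2) | AdjGoodP M k₀ K T T' Rg Kg ω} =
      ⋂ f ∈ (↑(Finset.range 6) : Set ℕ), ⋂ b ∈ (Set.univ : Set Bool),
        (fun ω => rotConfig f (colCfg b ω)) ⁻¹' {χ | SideGoodP M k₀ K T T' Rg Kg χ} := by
    ext ω; simp only [AdjGoodP, Set.mem_setOf_eq, Set.mem_iInter, Finset.coe_range, Set.mem_Iio, Set.mem_univ, Set.mem_preimage,
      forall_true_left]
  have key : ∀ (f : ℕ) (b : Bool), DeterminedBy ((fun ω => rotConfig f (colCfg b ω)) ⁻¹' {χ | SideGoodP M k₀ K T T' Rg Kg χ}) ↑(outAdjFinset M) := by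
    intro f b
    cases b
    · have e1 : (fun ω : SiteConfig (Site 2) => rotConfig f (colCfg false ω)) ⁻¹' {χ | SideGoodP M k₀ K T T' Rg Kg χ} =
          rotConfig f ⁻¹' {χ : Set (Site 2) | χᶜ ∈ {χ' : SiteConfig (Site 2) | SideGoodP M k₀ K T T' Rg Kg χ'}} := by
        ext ω
        simp only [Set.mem_preimage, Set.mem_setOf_eq]
        rw [show colCfg false ω = (colCfg true ω)ᶜ by ext v; simp [colCfg], show colCfg true ω = ω by ext v; simp [colCfg], rotConfig_compl]
      rw [e1]
      exact (determinedBy_preimage_rotConfig f (determinedBy_compl_mem hside)).mono (image_rot_outAdjFinset M f)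
    · have e1 : (fun ω : SiteConfig (Site 2) => rotConfig f (colCfg true ω)) ⁻¹' {χ | SideGoodP M k₀ K T T' Rg Kg χ} =
          rotConfig f ⁻¹' {χ' : SiteConfig (Site 2) | SideGoodP M k₀ K T T' Rg Kg χ'} := by
        ext ω
        simp only [Set.mem_preimage, Set.mem_setOf_eq]
        rw [show colCfg true ω = ω by ext v; simp [colCfg]]
      rw [e1]
      exact (determinedBy_preimage_rotConfig f hside).mono (image_rot_outAdjFinset M f)
  have h : DeterminedBy {ω : SiteConfig (Site 2) | AdjGoodP M k₀ K T T' Rg Kg ω} ↑(outAdjFinset M) := by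
    rw [e]
    exact DeterminedBy.biInter' fun f _ => DeterminedBy.biInter' fun b _ => key f b
  exact h.compl

/-- **The separation step "by independence"**: `E ⊆ G ∪ ({¬ AdjGoodP} ∩ A)` with `A` determined by
`Λ_M` gives `P_p(E) ≤ P_p(G) + P_p(¬ AdjGoodP) · P_p(A)`. [cite: Nolin2008, §4.4 (arXiv 0711.4948: proof of Thm. 10, p. 12); Kesten1987, Lemma 2] -/
theorem real_le_adjStep_at (p : unitInterval) {M k₀ K T T' Rg Kg Rg' : ℕ} (hM : 1 ≤ M) (hKM : ∀ j < K, 31 * trapScale k₀ j < M)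
    (hRg : ∀ l < Kg, 16 * trapScale Rg l ≤ Rg') (hRg'M : Rg' < M)
    {E G A : Set (SiteConfig (Site 2))} (hA : DeterminedBy A ↑(triBall M))
    (hsub : E ⊆ G ∪ ({ω | ¬ AdjGoodP M k₀ K T T' Rg Kg ω} ∩ A)) :
    (triSitePercolation p).real E ≤
      (triSitePercolation p).real G + (triSitePercolation p).real {ω | ¬ AdjGoodP M k₀ K T T' Rg Kg ω} * (triSitePercolation p).real A := by
  have dG := determinedBy_setOf_not_adjGoodP (T := T) (T' := T') hM hKM hRg hRg'M
  have hind := sitePercolation_real_inter_of_disjoint p dG hA (disjoint_outAdjFinset_triBall M)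
  unfold triSitePercolation at hind ⊢
  calc (sitePercolation (Site 2) p).real E
      ≤ (sitePercolation (Site 2) p).real (G ∪ ({ω | ¬ AdjGoodP M k₀ K T T' Rg Kg ω} ∩ A)) := measureReal_mono hsub (measure_ne_top _ _)
    _ ≤ (sitePercolation (Site 2) p).real G + (sitePercolation (Site 2) p).real ({ω | ¬ AdjGoodP M k₀ K T T' Rg Kg ω} ∩ A) :=
        measureReal_union_le _ _
    _ = _ := by rw [hind]

/-! ### The failure bound -/

/-- **Failure behind one side, at `p`**: `P_p(¬ SideGoodP) ≤ (1-c₄)^{T+1} + T b^K + (1-c₄)^{T'+1} + T' b^K + 3 (1-c_F²)^{K_g}`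
with `b = 1 - c_F² c_E c_I` (open frames of probability `≥ c_F` at `p` and at `1 - p`, closed rings
`≥ c_E, c_I` at `p`, the blocking crossing `c₄` at `1 - p`). [cite: Nolin2008, §4.4 Lemma 15 (arXiv 0711.4948: Lemma 14, (4.20)), with Thm. 11 "uniformly in p"] -/
theorem real_not_sideGoodP_le_at (p : unitInterval) {cF c₄ cE cI : ℝ} (hcF : 0 < cF) (hcF1 : cF ≤ 1) (hcE : 0 ≤ cE) (hcE1 : cE ≤ 1)
    (hcI : 0 ≤ cI) (hcI1 : cI ≤ 1) {M : ℕ} (hM : 3 ≤ M)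
    (hF : ∀ (z : Site 2) (k : ℕ), 1 ≤ k → k < M → cF ≤ (triSitePercolation p).real (triFrameAt z k))
    (hFσ : ∀ (z : Site 2) (k : ℕ), 1 ≤ k → k < M → cF ≤ (triSitePercolation (σ p)).real (triFrameAt z k))
    (hc₄ : c₄ ≤ triLRCrossingProb (σ p) (4 * (M - 1)) (M - 1))
    (hEr : ∀ (z : Site 2) (k : ℕ), 1 ≤ k → 32 * k < M → cE ≤ (triSitePercolation p).real (compl ⁻¹' triRingAt z k))
    (hIr : ∀ (z : Site 2) (k : ℕ), 1 ≤ k → 32 * k < M → cI ≤ (triSitePercolation p).real (compl ⁻¹' triInnerRingAt z k))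
    {k₀ K T T' Rg Kg : ℕ} (hk₀ : 1 ≤ k₀) (hKM : ∀ j < K, 32 * (trapScale k₀ j : ℤ) + 1 ≤ M) (hRg : 1 ≤ Rg)
    (hKgM : ∀ i < Kg, 8 * trapScale Rg i < M) :
    (triSitePercolation p).real {χ | ¬ SideGoodP M k₀ K T T' Rg Kg χ} ≤
      (1 - c₄) ^ (T + 1) + T * (1 - cF ^ 2 * cE * cI) ^ K + (1 - c₄) ^ (T' + 1) + T' * (1 - cF ^ 2 * cE * cI) ^ K +
        3 * (1 - cF ^ 2) ^ Kg := by
  have hM1 : 1 ≤ M := by omega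
  set b := (1 - cF ^ 2 * cE * cI) with hb
  -- the pieces
  have h1 := real_lowestSeq_ne_none_le_at p hM hc₄ T
  have hb00 : 0 ≤ b := by
    rw [hb]
    have : cF ^ 2 * cE * cI ≤ 1 := mul_le_one₀ (mul_le_one₀ (pow_le_one₀ hcF.le hcF1) hcE hcE1) hcI hcI1
    linarith
  have hb0 : 0 ≤ b ^ K := pow_nonneg hb00 K
  have h2 : ∀ u, (triSitePercolation p).real {ω | TrapSeqFailRaw M u k₀ K ω} ≤ b ^ K := fun u => by
    refine (real_trapSeqFailRaw_le_at p hcF hcF1 hcE hcE1 hcI hcI1 hF hEr hIr (u := u) hM1 hk₀ hKM).trans ?_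
    calc (triSitePercolation p).real {ω | (trapDomain M).lowestSeq ω u ≠ none} * b ^ K ≤ 1 * b ^ K :=
          mul_le_mul_of_nonneg_right measureReal_le_one hb0
      _ = b ^ K := one_mul _
  have h3 := real_flip_lowestSeq_ne_none_le_at p hM hc₄ T'
  have h4 : ∀ u, (triSitePercolation p).real {ω | TrapSeqFailRawUp M u k₀ K ω} ≤ b ^ K := fun u => by
    refine (real_trapSeqFailRawUp_le_at p hcF hcF1 hcE hcE1 hcI hcI1 hF hEr hIr (u := u) hM1 hk₀ hKM).trans ?_
    calc (triSitePercolation p).real {ω | (trapDomain M).flip.lowestSeq ω u ≠ none} * b ^ K ≤ 1 * b ^ K :=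
          mul_le_mul_of_nonneg_right measureReal_le_one hb0
      _ = b ^ K := one_mul _
  have h5 := fun C => real_not_inGuard_le_at p hcF hFσ hRg hKgM C
  -- the decomposition
  have hsub : {χ : SiteConfig (Site 2) | ¬ SideGoodP M k₀ K T T' Rg Kg χ} ⊆
      ((({ω | (trapDomain M).lowestSeq ω T ≠ none} ∪ ⋃ u ∈ Finset.range T, {ω | TrapSeqFailRaw M u k₀ K ω}) ∪
        {ω | (trapDomain M).flip.lowestSeq ω T' ≠ none}) ∪ ⋃ u ∈ Finset.range T', {ω | TrapSeqFailRawUp M u k₀ K ω}) ∪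
        (({χ | ¬ InGuard Rg Kg (extC₁ M) χ} ∪ {χ | ¬ InGuard Rg Kg (extC₂ M) χ}) ∪ {χ | ¬ InGuard Rg Kg (extC₃ M) χ}) := by
    intro χ hχ
    simp only [Set.mem_union, Set.mem_setOf_eq, Set.mem_iUnion, Finset.mem_range, exists_prop]
    by_contra hcon
    push Not at hcon
    obtain ⟨⟨⟨⟨a1, a2⟩, a3⟩, a4⟩, ⟨a5, a6⟩, a7⟩ := hcon
    exact hχ ⟨a1, fun u hu hf => a2 u hu hf, a3, fun u hu hf => a4 u hu hf, a5, a6, a7⟩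
  calc (triSitePercolation p).real {χ | ¬ SideGoodP M k₀ K T T' Rg Kg χ}
      ≤ (triSitePercolation p).real _ := measureReal_mono hsub (measure_ne_top _ _)
    _ ≤ ((((1 - c₄) ^ (T + 1) + T * b ^ K) + (1 - c₄) ^ (T' + 1)) + T' * b ^ K) + (((1 - cF ^ 2) ^ Kg + (1 - cF ^ 2) ^ Kg) + (1 - cF ^ 2) ^ Kg) := by
        refine (measureReal_union_le _ _).trans (add_le_add ?_ ?_)
        · refine (measureReal_union_le _ _).trans (add_le_add ?_ ?_)
          · refine (measureReal_union_le _ _).trans (add_le_add ?_ h3)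
            refine (measureReal_union_le _ _).trans (add_le_add h1 ?_)
            refine (measureReal_biUnion_finset_le _ _).trans ?_
            calc ∑ u ∈ Finset.range T, (triSitePercolation p).real {ω | TrapSeqFailRaw M u k₀ K ω}
                ≤ ∑ u ∈ Finset.range T, b ^ K := Finset.sum_le_sum fun u _ => h2 u
              _ = T * b ^ K := by rw [Finset.sum_const, Finset.card_range, nsmul_eq_mul]
          · refine (measureReal_biUnion_finset_le _ _).trans ?_
            calc ∑ u ∈ Finset.range T', (triSitePercolation p).real {ω | TrapSeqFailRawUp M u k₀ K ω}
                ≤ ∑ u ∈ Finset.range T', b ^ K := Finset.sum_le_sum fun u _ => h4 u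
              _ = T' * b ^ K := by rw [Finset.sum_const, Finset.card_range, nsmul_eq_mul]
        · exact (measureReal_union_le _ _).trans (add_le_add ((measureReal_union_le _ _).trans (add_le_add (h5 _) (h5 _))) (h5 _))
    _ = _ := by ring

/-- **Failure around `∂Λ_{2M}`, at `p`**: `P_p(¬ AdjGoodP) ≤ 12 · B` where `B` is the one-side bound
of `real_not_sideGoodP_le_at`, the inputs holding at `p` and at `1 - p` (six rotated copies of law
`P_p`, six colour-exchanged ones of law `P_{1-p}`). [cite: Nolin2008, §4.4 Lemma 15 and Thm. 11 (proof) (arXiv 0711.4948: Lemma 14 (4.20), Thm. 10), with Thm. 11 "uniformly in p"] -/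
theorem real_not_adjGoodP_le_at (p : unitInterval) {cF c₄ cE cI : ℝ} (hcF : 0 < cF) (hcF1 : cF ≤ 1) (hcE : 0 ≤ cE) (hcE1 : cE ≤ 1)
    (hcI : 0 ≤ cI) (hcI1 : cI ≤ 1) {M : ℕ} (hM : 3 ≤ M)
    (hF : ∀ q : unitInterval, (q = p ∨ q = σ p) → ∀ (z : Site 2) (k : ℕ), 1 ≤ k → k < M → cF ≤ (triSitePercolation q).real (triFrameAt z k))
    (hc₄ : ∀ q : unitInterval, (q = p ∨ q = σ p) → c₄ ≤ triLRCrossingProb q (4 * (M - 1)) (M - 1))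
    (hEr : ∀ q : unitInterval, (q = p ∨ q = σ p) →
      ∀ (z : Site 2) (k : ℕ), 1 ≤ k → 32 * k < M → cE ≤ (triSitePercolation q).real (compl ⁻¹' triRingAt z k))
    (hIr : ∀ q : unitInterval, (q = p ∨ q = σ p) →
      ∀ (z : Site 2) (k : ℕ), 1 ≤ k → 32 * k < M → cI ≤ (triSitePercolation q).real (compl ⁻¹' triInnerRingAt z k))
    {k₀ K T T' Rg Kg : ℕ} (hk₀ : 1 ≤ k₀) (hKM : ∀ j < K, 32 * (trapScale k₀ j : ℤ) + 1 ≤ M) (hRg : 1 ≤ Rg)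
    (hKgM : ∀ i < Kg, 8 * trapScale Rg i < M) :
    (triSitePercolation p).real {ω | ¬ AdjGoodP M k₀ K T T' Rg Kg ω} ≤
      12 * ((1 - c₄) ^ (T + 1) + T * (1 - cF ^ 2 * cE * cI) ^ K + (1 - c₄) ^ (T' + 1) + T' * (1 - cF ^ 2 * cE * cI) ^ K +
        3 * (1 - cF ^ 2) ^ Kg) := by
  set B := {χ : SiteConfig (Site 2) | ¬ SideGoodP M k₀ K T T' Rg Kg χ} with hB
  set ε := (1 - c₄) ^ (T + 1) + T * (1 - cF ^ 2 * cE * cI) ^ K + (1 - c₄) ^ (T' + 1) + T' * (1 - cF ^ 2 * cE * cI) ^ K +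
        3 * (1 - cF ^ 2) ^ Kg with hε
  have hσσ : σ (σ p) = p := unitInterval.symm_symm p
  have hbad : (triSitePercolation p).real B ≤ ε :=
    real_not_sideGoodP_le_at p hcF hcF1 hcE hcE1 hcI hcI1 hM (hF p (Or.inl rfl)) (hF (σ p) (Or.inr rfl)) (hc₄ (σ p) (Or.inr rfl))
      (hEr p (Or.inl rfl)) (hIr p (Or.inl rfl)) hk₀ hKM hRg hKgM
  have hbad' : (triSitePercolation (σ p)).real B ≤ ε := by
    refine real_not_sideGoodP_le_at (σ p) hcF hcF1 hcE hcE1 hcI hcI1 hM (hF (σ p) (Or.inr rfl)) ?_ ?_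
      (hEr (σ p) (Or.inr rfl)) (hIr (σ p) (Or.inr rfl)) hk₀ hKM hRg hKgM
    · rw [hσσ]; exact hF p (Or.inl rfl)
    · rw [hσσ]; exact hc₄ p (Or.inl rfl)
  have hrot : ∀ i : ℕ, (triSitePercolation p).real (rotConfig i ⁻¹' B) ≤ ε := fun i => by
    rw [real_preimage_rotConfig]; exact hbad
  have hrotc : ∀ i : ℕ, (triSitePercolation p).real (rotConfig i ⁻¹' (compl ⁻¹' B)) ≤ ε := fun i => by
    rw [real_preimage_rotConfig]
    unfold triSitePercolation
    rw [sitePercolation_real_preimage_compl]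
    exact hbad'
  have hsub : {ω : SiteConfig (Site 2) | ¬ AdjGoodP M k₀ K T T' Rg Kg ω} ⊆
      ⋃ i ∈ Finset.range 6, (rotConfig i ⁻¹' B ∪ rotConfig i ⁻¹' (compl ⁻¹' B)) := by
    intro ω hω
    simp only [AdjGoodP, Set.mem_setOf_eq, not_forall] at hω
    obtain ⟨f, hf, b, hb⟩ := hω
    simp only [Set.mem_iUnion, Finset.mem_range, Set.mem_union, Set.mem_preimage, exists_prop]
    refine ⟨f, hf, ?_⟩
    cases b
    · right
      have e : (rotConfig f ω)ᶜ = rotConfig f (colCfg false ω) := by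
        rw [rotConfig_compl, show colCfg false ω = ωᶜ by ext v; simp [colCfg]]
      show ¬ SideGoodP M k₀ K T T' Rg Kg (rotConfig f ω)ᶜ
      rw [e]; exact hb
    · left
      show ¬ SideGoodP M k₀ K T T' Rg Kg (rotConfig f ω)
      rw [← show colCfg true ω = ω by ext v; simp [colCfg]]; exact hb
  calc (triSitePercolation p).real {ω | ¬ AdjGoodP M k₀ K T T' Rg Kg ω}
      ≤ (triSitePercolation p).real (⋃ i ∈ Finset.range 6, (rotConfig i ⁻¹' B ∪ rotConfig i ⁻¹' (compl ⁻¹' B))) :=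
        measureReal_mono hsub (measure_ne_top _ _)
    _ ≤ ∑ i ∈ Finset.range 6, (triSitePercolation p).real (rotConfig i ⁻¹' B ∪ rotConfig i ⁻¹' (compl ⁻¹' B)) :=
        measureReal_biUnion_finset_le _ _
    _ ≤ ∑ i ∈ Finset.range 6, (ε + ε) := Finset.sum_le_sum fun i _ => (measureReal_union_le _ _).trans (add_le_add (hrot i) (hrotc i))
    _ = 12 * ε := by rw [Finset.sum_const, Finset.card_range, nsmul_eq_mul]; push_cast; ring

end Literature.Probability.Percolation
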